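import Mathlib.Analysis.SpecialFunctions.Pow.Deriv
import Mathlib.Analysis.SpecialFunctions.Integrals.Basic
import Mathlib.MeasureTheory.Integral.IntervalIntegral.FundThmCalculus
import Literature.NumberTheory.Sieve.BetaSieveForward
import HarnessLib

/-!
# Buchstab's function `ω(u)`

Topic `Literature/NumberTheory/Sieve`. Buchstab's function is the continuous function on `[1, ∞)`
with
`ω(u) = 1/u` for `1 ≤ u ≤ 2` and `(u ω(u))' = ω(u − 1)` for `u > 2`
(Lichtman, *A modification of the linear sieve, and the count of twin primes*, §6.1, the display
before Lemma 6.1; Harman, *Prime-Detecting Sieves*, §1.4: "`ω(u) = u⁻¹` for `1 ≤ u ≤ 2` and …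
`ω(u) = u⁻¹ (k ω(k) + ∫_k^u ω(v − 1) dv)` for `k ≤ u ≤ k + 1`"). It is the density of the
`y`-rough numbers: `Φ(x, y) ∼ ω(u) x / log y` for `y = x^{1/u}`, `u > 1` fixed (Lichtman's
Lemma 6.1, proved in `RoughNumbersBuchstab*.lean`). Lichtman also records
`ω(u) = (f(u) + F(u))/(2e^γ)` with the linear sieve functions `F, f`; accordingly we DEFINE `ω`
from the tree's forward solution of the linear (`κ = 1`, `β = 2`) sieve system with the
normalisation `A = 1` (`BetaSieveForward.upper 1 2 1 = F/(2e^γ)`, `BetaSieveForward.lower 1 2 1 =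
f/(2e^γ)` up to the common factor, which is all that matters here): `ω = F₁ + f₁` on `[1, ∞)`,
where `s F₁(s) = 1` on `(0, 3]`, `f₁ = 0` on `(0, 2]`, `(s F₁)' = f₁(s − 1)` (`s > 3`),
`(s f₁)' = F₁(s − 1)` (`s > 2`); and `ω = 0` on `(−∞, 1)` (the natural convention: there are no
`y`-rough integers in `(1, x]` when `y > x`).

## Main results (all PROVED, no named facts)

* `buchstabOmega_eq_inv` — `ω(u) = u⁻¹` on `[1, 2]`; `buchstabOmega_of_lt_one` — `ω = 0` below `1`.
* `continuousOn_buchstabOmega` — `ω` is continuous on `[1, ∞)`.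
* `mul_buchstabOmega_sub_eq_integral` — the integral equation
  `b ω(b) − a ω(a) = ∫_a^b ω(t − 1) dt` for `2 ≤ a ≤ b`.
* `hasDerivAt_mul_buchstabOmega` — `(u ω(u))' = ω(u − 1)` for every `u > 2`;
  `hasDerivAt_buchstabOmega` — `ω'(u) = (ω(u − 1) − ω(u))/u` for `u > 2`.
* `half_le_buchstabOmega`, `buchstabOmega_le_one` — `1/2 ≤ ω(u) ≤ 1` for `u ≥ 1` (Harman §1.4).
* `buchstabOmega_eq_of_mem_Icc_two_three` — `ω(u) = (1 + log(u − 1))/u` on `[2, 3]` (Harman (1.4.16)).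

## References

* J. D. Lichtman, *A modification of the linear sieve, and the count of twin primes*, Algebra &
  Number Theory 19 (2025) 1–38, arXiv:2109.02851, §6.1. [Lichtman2025LinearSieve]
* G. Harman, *Prime-Detecting Sieves*, LMS Monographs 33, Princeton UP (2007), §1.4 (1.4.13)–(1.4.16)
  and Appendix A.2.
-/

open Set Filter MeasureTheory intervalIntegral
open scoped Topology

noncomputable section

namespace Literature.NumberTheory.Sieve

/-- **Buchstab's function** `ω`: `ω(u) = 0` for `u < 1`, and for `u ≥ 1` the sum `F₁(u) + f₁(u)`
of the forward solution of the linear sieve system normalised by `A = 1`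
(`BetaSieveForward.upper 1 2 1`, `BetaSieveForward.lower 1 2 1`), so that `ω(u) = 1/u` on `[1, 2]`
and `(u ω(u))' = ω(u − 1)` for `u > 2` (Lichtman §6.1: "`ω(u) = (f(u) + F(u))/(2e^γ)`. Alternatively,
`ω` is directly defined via `ω(u) = 1/u` for `1 ≤ u ≤ 2`, `(u ω(u))' = ω(u − 1)` for `2 ≤ u`").
[cite: Lichtman2025LinearSieve, §6.1 (display before Lemma 6.1)] -/
def buchstabOmega (u : ℝ) : ℝ :=
  if u < 1 then 0 else BetaSieveForward.upper 1 2 1 u + BetaSieveForward.lower 1 2 1 u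

/-- `ω(u) = 0` for `u < 1`. [folklore] -/
theorem buchstabOmega_of_lt_one {u : ℝ} (hu : u < 1) : buchstabOmega u = 0 := by
  simp [buchstabOmega, hu]

/-- For `u ≥ 1`, `ω(u) = F₁(u) + f₁(u)`. [folklore] -/
theorem buchstabOmega_eq_add {u : ℝ} (hu : 1 ≤ u) :
    buchstabOmega u = BetaSieveForward.upper 1 2 1 u + BetaSieveForward.lower 1 2 1 u := by
  simp [buchstabOmega, not_lt.mpr hu]

/-- `F₁(s) = s⁻¹` for `s ≤ 3` (the initial value `A s^{−κ}` with `A = 1`, `κ = 1`). [folklore] -/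
theorem upper_one_two_one_eq {s : ℝ} (hs : s ≤ 3) : BetaSieveForward.upper 1 2 1 s = s⁻¹ := by
  rw [BetaSieveForward.upper_eq (by norm_num; exact hs), Real.rpow_neg_one, one_mul]

/-- `f₁(s) = 0` for `s ≤ 2`. [folklore] -/
theorem lower_one_two_one_eq {s : ℝ} (hs : s ≤ 2) : BetaSieveForward.lower 1 2 1 s = 0 :=
  BetaSieveForward.lower_eq hs

/-- **`ω(u) = 1/u` for `1 ≤ u ≤ 2`.** [cite: Lichtman2025LinearSieve, §6.1 (display before Lemma 6.1)] -/
theorem buchstabOmega_eq_inv {u : ℝ} (h1 : 1 ≤ u) (h2 : u ≤ 2) : buchstabOmega u = u⁻¹ := by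
  rw [buchstabOmega_eq_add h1, upper_one_two_one_eq (by linarith), lower_one_two_one_eq h2, add_zero]

/-- `ω(1) = 1`. [folklore] -/
theorem buchstabOmega_one : buchstabOmega 1 = 1 := by
  rw [buchstabOmega_eq_inv le_rfl (by norm_num), inv_one]

/-- `ω(2) = 1/2`. [folklore] -/
theorem buchstabOmega_two : buchstabOmega 2 = 2⁻¹ :=
  buchstabOmega_eq_inv (by norm_num) le_rfl

/-- `ω` is continuous on `[1, ∞)`. [folklore] -/
theorem continuousOn_buchstabOmega : ContinuousOn buchstabOmega (Ici 1) := by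
  have hF := BetaSieveForward.continuousOn_upper (κ := 1) (β := 2) (A := 1) (by norm_num)
  have hf := BetaSieveForward.continuousOn_lower (κ := 1) (β := 2) (A := 1) (by norm_num)
  have h : ContinuousOn (fun u => BetaSieveForward.upper 1 2 1 u + BetaSieveForward.lower 1 2 1 u)
      (Ici 1) := (hF.add hf).mono fun u (hu : 1 ≤ u) => show (0 : ℝ) < u by linarith
  exact h.congr fun u (hu : 1 ≤ u) => buchstabOmega_eq_add hu

/-- `ω` is continuous at every `u > 1`. [folklore] -/
theorem continuousAt_buchstabOmega {u : ℝ} (hu : 1 < u) : ContinuousAt buchstabOmega u :=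
  continuousOn_buchstabOmega.continuousAt (Ici_mem_nhds hu)

/-- `t ↦ ω(t − 1)` is continuous on `[2, ∞)`. [folklore] -/
theorem continuousOn_buchstabOmega_sub_one : ContinuousOn (fun t : ℝ => buchstabOmega (t - 1)) (Ici 2) :=
  continuousOn_buchstabOmega.comp (continuousOn_id.sub continuousOn_const)
    fun t (ht : 2 ≤ t) => show 1 ≤ t - 1 by linarith

/-- `t ↦ t ω(t)` is continuous on `[1, ∞)`. [folklore] -/
theorem continuousOn_mul_buchstabOmega : ContinuousOn (fun t : ℝ => t * buchstabOmega t) (Ici 1) :=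
  continuousOn_id.mul continuousOn_buchstabOmega

/-! ### The delay-differential equation -/

/-- `(t ω(t))' = ω(s − 1)` at `2 < s < 3`: here `t F₁(t) = 1` is locally constant and
`(t f₁(t))' = F₁(s − 1) = (s − 1)⁻¹ = ω(s − 1)`. [folklore] -/
theorem hasDerivAt_mul_buchstabOmega_of_lt_three {s : ℝ} (hs : 2 < s) (hs3 : s < 3) :
    HasDerivAt (fun t : ℝ => t * buchstabOmega t) (buchstabOmega (s - 1)) s := by
  have hlow := BetaSieveForward.hasDerivAt_lower (κ := 1) (β := 2) (A := 1) (by norm_num) hs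
  have hlow' : HasDerivAt (fun t : ℝ => t * BetaSieveForward.lower 1 2 1 t)
      (BetaSieveForward.upper 1 2 1 (s - 1)) s := by
    have h2 := hlow.congr_deriv (by rw [sub_self, Real.rpow_zero, one_mul, one_mul])
    refine h2.congr_of_eventuallyEq ?_
    filter_upwards [Ioi_mem_nhds (by linarith : (0 : ℝ) < s)] with t (ht : 0 < t)
    rw [Real.rpow_one]
  have hup : HasDerivAt (fun t : ℝ => t * BetaSieveForward.upper 1 2 1 t) 0 s := by
    refine (hasDerivAt_const s (1 : ℝ)).congr_of_eventuallyEq ?_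
    filter_upwards [Ioo_mem_nhds (by linarith : (0 : ℝ) < s) hs3] with t ht
    rw [upper_one_two_one_eq ht.2.le, mul_inv_cancel₀ ht.1.ne']
  have hsum := hup.add hlow'
  rw [zero_add, upper_one_two_one_eq (by linarith), ← buchstabOmega_eq_inv (by linarith) (by linarith)]
    at hsum
  refine hsum.congr_of_eventuallyEq ?_
  filter_upwards [Ioi_mem_nhds (by linarith : (1 : ℝ) < s)] with t (ht : 1 < t)
  simp only [Pi.add_apply, buchstabOmega_eq_add ht.le, mul_add]

/-- `(t ω(t))' = ω(s − 1)` at `s > 3`: `(t F₁(t))' = f₁(s − 1)` and `(t f₁(t))' = F₁(s − 1)`.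
[folklore] -/
theorem hasDerivAt_mul_buchstabOmega_of_three_lt {s : ℝ} (hs : 3 < s) :
    HasDerivAt (fun t : ℝ => t * buchstabOmega t) (buchstabOmega (s - 1)) s := by
  have hlow := BetaSieveForward.hasDerivAt_lower (κ := 1) (β := 2) (A := 1) (by norm_num)
    (by linarith : (2 : ℝ) < s)
  have hup := BetaSieveForward.hasDerivAt_upper (κ := 1) (β := 2) (A := 1) (by norm_num)
    (by norm_num; exact hs)
  have hlow' : HasDerivAt (fun t : ℝ => t * BetaSieveForward.lower 1 2 1 t)
      (BetaSieveForward.upper 1 2 1 (s - 1)) s := by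
    have h2 := hlow.congr_deriv (by rw [sub_self, Real.rpow_zero, one_mul, one_mul])
    refine h2.congr_of_eventuallyEq ?_
    filter_upwards [Ioi_mem_nhds (by linarith : (0 : ℝ) < s)] with t (ht : 0 < t)
    rw [Real.rpow_one]
  have hup' : HasDerivAt (fun t : ℝ => t * BetaSieveForward.upper 1 2 1 t)
      (BetaSieveForward.lower 1 2 1 (s - 1)) s := by
    have h2 := hup.congr_deriv (by rw [sub_self, Real.rpow_zero, one_mul, one_mul])
    refine h2.congr_of_eventuallyEq ?_
    filter_upwards [Ioi_mem_nhds (by linarith : (0 : ℝ) < s)] with t (ht : 0 < t)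
    rw [Real.rpow_one]
  have hsum := (hup'.add hlow').congr_deriv
    (show _ = buchstabOmega (s - 1) by rw [add_comm, ← buchstabOmega_eq_add (by linarith)])
  refine hsum.congr_of_eventuallyEq ?_
  filter_upwards [Ioi_mem_nhds (by linarith : (1 : ℝ) < s)] with t (ht : 1 < t)
  simp only [Pi.add_apply, buchstabOmega_eq_add ht.le, mul_add]


/-- FTC on an interval `[a, b] ⊆ [2, 3]` or `⊆ [3, ∞)`: `∫_a^b ω(t − 1) dt = b ω(b) − a ω(a)`. [folklore] -/
private theorem integral_buchstabOmega_sub_one_aux {a b : ℝ} (ha : 2 ≤ a) (hab : a ≤ b)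
    (h3 : b ≤ 3 ∨ 3 ≤ a) :
    ∫ t in a..b, buchstabOmega (t - 1) = b * buchstabOmega b - a * buchstabOmega a := by
  apply intervalIntegral.integral_eq_sub_of_hasDerivAt_of_le hab
  · exact continuousOn_mul_buchstabOmega.mono fun t ht => le_trans (by norm_num) (ha.trans ht.1)
  · intro t ht
    rcases h3 with h3 | h3
    · exact hasDerivAt_mul_buchstabOmega_of_lt_three (by linarith [ht.1]) (by linarith [ht.2])
    · exact hasDerivAt_mul_buchstabOmega_of_three_lt (by linarith [ht.1])
  · refine (continuousOn_buchstabOmega_sub_one.mono ?_).intervalIntegrable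
    rw [uIcc_of_le hab]
    exact fun t ht => ha.trans ht.1

/-- `t ↦ ω(t − 1)` is interval integrable on every `[a, b]` with `2 ≤ a`, `2 ≤ b`. [folklore] -/
theorem intervalIntegrable_buchstabOmega_sub_one {a b : ℝ} (ha : 2 ≤ a) (hb : 2 ≤ b) :
    IntervalIntegrable (fun t : ℝ => buchstabOmega (t - 1)) volume a b := by
  refine (continuousOn_buchstabOmega_sub_one.mono ?_).intervalIntegrable
  intro t ht
  rw [mem_uIcc] at ht
  rcases ht with ht | ht
  · exact ha.trans ht.1
  · exact hb.trans ht.1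

/-- **The integral equation of Buchstab's function**: for `2 ≤ a ≤ b`,
`b ω(b) − a ω(a) = ∫_a^b ω(t − 1) dt` (Harman §1.4: `ω(u) = u⁻¹(k ω(k) + ∫_k^u ω(v − 1) dv)`).
[cite: Lichtman2025LinearSieve, §6.1 (display before Lemma 6.1)] -/
theorem mul_buchstabOmega_sub_eq_integral {a b : ℝ} (ha : 2 ≤ a) (hab : a ≤ b) :
    b * buchstabOmega b - a * buchstabOmega a = ∫ t in a..b, buchstabOmega (t - 1) := by
  rcases le_or_gt b 3 with hb3 | hb3
  · rw [integral_buchstabOmega_sub_one_aux ha hab (Or.inl hb3)]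
  rcases le_or_gt 3 a with ha3 | ha3
  · rw [integral_buchstabOmega_sub_one_aux ha hab (Or.inr ha3)]
  -- `a < 3 < b`: split at `3`
  rw [← intervalIntegral.integral_add_adjacent_intervals (b := 3)
      (intervalIntegrable_buchstabOmega_sub_one ha (by norm_num))
      (intervalIntegrable_buchstabOmega_sub_one (by norm_num) (by linarith)),
    integral_buchstabOmega_sub_one_aux ha ha3.le (Or.inl le_rfl),
    integral_buchstabOmega_sub_one_aux (by norm_num) hb3.le (Or.inr le_rfl)]
  ring

/-- `u ω(u) = 1 + ∫_2^u ω(t − 1) dt` for `u ≥ 2` (since `2 ω(2) = 1`). [folklore] -/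
theorem mul_buchstabOmega_eq_one_add_integral {u : ℝ} (hu : 2 ≤ u) :
    u * buchstabOmega u = 1 + ∫ t in (2 : ℝ)..u, buchstabOmega (t - 1) := by
  rw [← mul_buchstabOmega_sub_eq_integral le_rfl hu, buchstabOmega_two]
  ring

/-- **`(u ω(u))' = ω(u − 1)` for every `u > 2`** (including `u = 3`), by the fundamental theorem of
calculus applied to the integral equation. [cite: Lichtman2025LinearSieve, §6.1 (display before Lemma 6.1)] -/
theorem hasDerivAt_mul_buchstabOmega {s : ℝ} (hs : 2 < s) :
    HasDerivAt (fun t : ℝ => t * buchstabOmega t) (buchstabOmega (s - 1)) s := by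
  have h1 : HasDerivAt (fun t : ℝ => ∫ v in (2 : ℝ)..t, buchstabOmega (v - 1))
      (buchstabOmega (s - 1)) s := by
    apply intervalIntegral.integral_hasDerivAt_right
    · exact intervalIntegrable_buchstabOmega_sub_one le_rfl hs.le
    · exact (continuousOn_buchstabOmega_sub_one.mono Ioi_subset_Ici_self).stronglyMeasurableAtFilter
        isOpen_Ioi s hs
    · exact continuousOn_buchstabOmega_sub_one.continuousAt (Ici_mem_nhds hs)
  refine (h1.const_add 1).congr_of_eventuallyEq ?_
  filter_upwards [Ioi_mem_nhds hs] with t (ht : 2 < t)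
  exact mul_buchstabOmega_eq_one_add_integral ht.le

/-- **`ω'(u) = (ω(u − 1) − ω(u))/u` for `u > 2`.** [folklore] -/
theorem hasDerivAt_buchstabOmega {s : ℝ} (hs : 2 < s) :
    HasDerivAt buchstabOmega ((buchstabOmega (s - 1) - buchstabOmega s) / s) s := by
  have hs0 : s ≠ 0 := ne_of_gt (by linarith)
  have h := (hasDerivAt_mul_buchstabOmega hs).div (hasDerivAt_id s) hs0
  have h' : HasDerivAt buchstabOmega
      ((buchstabOmega (s - 1) * id s - s * buchstabOmega s * 1) / id s ^ 2) s := by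
    refine h.congr_of_eventuallyEq ?_
    filter_upwards [Ioi_mem_nhds (by linarith : (0 : ℝ) < s)] with t (ht : 0 < t)
    change buchstabOmega t = t * buchstabOmega t / t
    rw [mul_comm, mul_div_assoc, div_self ht.ne', mul_one]
  refine h'.congr_deriv ?_
  change (buchstabOmega (s - 1) * s - s * buchstabOmega s * 1) / s ^ 2 =
    (buchstabOmega (s - 1) - buchstabOmega s) / s
  rw [div_eq_div_iff (pow_ne_zero 2 hs0) hs0]
  ring

/-- The derivative `(ω(u − 1) − ω(u))/u` is continuous on `(2, ∞)` (so `ω ∈ C¹(2, ∞)`). [folklore] -/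
theorem continuousOn_deriv_buchstabOmega :
    ContinuousOn (fun s : ℝ => (buchstabOmega (s - 1) - buchstabOmega s) / s) (Ioi 2) := by
  refine ContinuousOn.div ?_ continuousOn_id fun s (hs : 2 < s) => ne_of_gt (by linarith)
  exact (continuousOn_buchstabOmega_sub_one.mono Ioi_subset_Ici_self).sub
    (continuousOn_buchstabOmega.mono fun s (hs : 2 < s) => show (1 : ℝ) ≤ s by linarith)

/-- `ω'(u) = −1/u²` for `1 < u < 2`. [folklore] -/
theorem hasDerivAt_buchstabOmega_of_lt_two {s : ℝ} (h1 : 1 < s) (h2 : s < 2) :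
    HasDerivAt buchstabOmega (-(s ^ 2)⁻¹) s := by
  refine (hasDerivAt_inv (ne_of_gt (by linarith) : s ≠ 0)).congr_of_eventuallyEq ?_
  filter_upwards [Ioo_mem_nhds h1 h2] with t ht
  exact buchstabOmega_eq_inv ht.1.le ht.2.le

/-! ### Bounds: `1/2 ≤ ω ≤ 1` -/

/-- `1/2 ≤ ω(u) ≤ 1` on `[1, n + 2]`, by induction on `n` through the integral equation
(Harman §1.4: "It follows immediately from this that `1/2 ≤ ω(u) ≤ 1` for all `u`"). [folklore] -/
theorem buchstabOmega_mem_Icc_aux : ∀ n : ℕ, ∀ u : ℝ, 1 ≤ u → u ≤ n + 2 →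
    buchstabOmega u ∈ Icc (1 / 2 : ℝ) 1
  | 0 => by
    intro u h1 h2
    rw [Nat.cast_zero, zero_add] at h2
    rw [buchstabOmega_eq_inv h1 h2]
    constructor
    · rw [one_div]; exact inv_anti₀ (by linarith) h2
    · exact inv_le_one_of_one_le₀ h1
  | n + 1 => by
    intro u h1 h2
    rcases le_or_gt u (n + 2) with hu | hu
    · exact buchstabOmega_mem_Icc_aux n u h1 hu
    -- `u ∈ (n + 2, n + 3]`: integrate from `a = n + 2`
    set a : ℝ := n + 2 with ha_def
    have ha2 : 2 ≤ a := by rw [ha_def]; linarith [(Nat.cast_nonneg n : (0 : ℝ) ≤ n)]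
    have hau : a ≤ u := hu.le
    have hIH : ∀ t ∈ Icc a u, buchstabOmega (t - 1) ∈ Icc (1 / 2 : ℝ) 1 := fun t ht =>
      buchstabOmega_mem_Icc_aux n (t - 1) (by linarith [ht.1]) (by push_cast at h2 ⊢; linarith [ht.2])
    have ha_mem : buchstabOmega a ∈ Icc (1 / 2 : ℝ) 1 :=
      buchstabOmega_mem_Icc_aux n a (by linarith) le_rfl
    have hint := intervalIntegrable_buchstabOmega_sub_one ha2 (ha2.trans hau)
    have hlow : ∫ _ in a..u, (1 / 2 : ℝ) ≤ ∫ t in a..u, buchstabOmega (t - 1) :=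
      intervalIntegral.integral_mono_on hau intervalIntegrable_const hint fun t ht => (hIH t ht).1
    have hupp : ∫ t in a..u, buchstabOmega (t - 1) ≤ ∫ _ in a..u, (1 : ℝ) :=
      intervalIntegral.integral_mono_on hau hint intervalIntegrable_const fun t ht => (hIH t ht).2
    rw [intervalIntegral.integral_const, smul_eq_mul] at hlow hupp
    have heq := mul_buchstabOmega_sub_eq_integral ha2 hau
    have hu0 : 0 < u := by linarith
    constructor
    · rw [one_div, inv_le_iff_one_le_mul₀ (by norm_num : (0 : ℝ) < 2)]
      -- `u/2 ≤ u ω(u)`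
      have : u / 2 ≤ u * buchstabOmega u := by nlinarith [ha_mem.1, hlow, heq]
      nlinarith
    · -- `u ω(u) ≤ u`
      have : u * buchstabOmega u ≤ u := by nlinarith [ha_mem.2, hupp, heq]
      exact le_of_mul_le_mul_left (by linarith) hu0

/-- **`1/2 ≤ ω(u)` for `u ≥ 1`.** [folklore] -/
theorem half_le_buchstabOmega {u : ℝ} (hu : 1 ≤ u) : 1 / 2 ≤ buchstabOmega u := by
  obtain ⟨n, hn⟩ := exists_nat_ge (u - 2)
  exact (buchstabOmega_mem_Icc_aux n u hu (by linarith)).1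

/-- **`ω(u) ≤ 1` for all `u`.** [folklore] -/
theorem buchstabOmega_le_one (u : ℝ) : buchstabOmega u ≤ 1 := by
  rcases lt_or_ge u 1 with hu | hu
  · rw [buchstabOmega_of_lt_one hu]; exact zero_le_one
  obtain ⟨n, hn⟩ := exists_nat_ge (u - 2)
  exact (buchstabOmega_mem_Icc_aux n u hu (by linarith)).2

/-- `0 ≤ ω(u)` for all `u`. [folklore] -/
theorem buchstabOmega_nonneg (u : ℝ) : 0 ≤ buchstabOmega u := by
  rcases lt_or_ge u 1 with hu | hu
  · rw [buchstabOmega_of_lt_one hu]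
  · linarith [half_le_buchstabOmega hu]

/-- `|ω(u)| ≤ 1` for all `u`. [folklore] -/
theorem abs_buchstabOmega_le_one (u : ℝ) : |buchstabOmega u| ≤ 1 := by
  rw [abs_of_nonneg (buchstabOmega_nonneg u)]; exact buchstabOmega_le_one u

/-- **`|ω'(u)| ≤ 1/4` for `u > 2`**: `|ω(u − 1) − ω(u)| ≤ 1/2` as both values lie in `[1/2, 1]`.
[folklore] -/
theorem abs_deriv_buchstabOmega_le {s : ℝ} (hs : 2 < s) :
    |(buchstabOmega (s - 1) - buchstabOmega s) / s| ≤ 1 / 4 := by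
  have h1 := half_le_buchstabOmega (by linarith : (1 : ℝ) ≤ s - 1)
  have h2 := buchstabOmega_le_one (s - 1)
  have h3 := half_le_buchstabOmega (by linarith : (1 : ℝ) ≤ s)
  have h4 := buchstabOmega_le_one s
  rw [abs_div, abs_of_pos (by linarith : (0 : ℝ) < s), div_le_iff₀ (by linarith : (0 : ℝ) < s),
    abs_le]
  constructor <;> nlinarith

/-! ### The explicit value on `[2, 3]` -/

/-- **`ω(u) = (1 + log(u − 1))/u` for `2 ≤ u ≤ 3`** (Harman, *Prime-Detecting Sieves*, (1.4.16)):
`u ω(u) = 1 + ∫_2^u dt/(t − 1)`. [folklore] -/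
theorem buchstabOmega_eq_of_mem_Icc_two_three {u : ℝ} (h2 : 2 ≤ u) (h3 : u ≤ 3) :
    buchstabOmega u = (1 + Real.log (u - 1)) / u := by
  have hu0 : 0 < u := by linarith
  have hint : ∫ t in (2 : ℝ)..u, buchstabOmega (t - 1) = Real.log (u - 1) := by
    have hcongr : ∫ t in (2 : ℝ)..u, buchstabOmega (t - 1) = ∫ t in (2 : ℝ)..u, (t - 1)⁻¹ := by
      refine intervalIntegral.integral_congr fun t ht => ?_
      rw [uIcc_of_le h2] at ht
      exact buchstabOmega_eq_inv (by linarith [ht.1]) (by linarith [ht.2])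
    rw [hcongr, intervalIntegral.integral_comp_sub_right (fun t : ℝ => t⁻¹) 1,
      integral_inv_of_pos (by norm_num) (by linarith)]
    norm_num
  rw [eq_div_iff hu0.ne', mul_comm, mul_buchstabOmega_eq_one_add_integral h2, hint]

end Literature.NumberTheory.Sieve
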